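import Literature.AnabelianGeometry.EtaleTheta.ThetaCoversMonodromyModelLoopShadow
import HarnessLib

/-!
# The MONODROMY TOY with the LOOP-cut `(1, l-tors)` covering ([EtTh] §2 Def. 2.1 / 2.3 / 2.5), part 2 (DEF-BEARING):
# the Def. 2.1 / 2.3 data over `Π_C` and a second `TemperedCoverData` over abc-iut-w6-d084's profinite data, in which
# `X̲ → X` kills the LOOP INDEX mod `l` (Def. 2.5 (i)(a) HOLDS) instead of the `a`-cycle
# (part 1 = `ThetaCoversMonodromyModelLoopShadow.lean`: the shadow subgroups `heisV`, `heisVS`, `heisBax`, `heisBS`)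

S. Mochizuki, *The étale theta function and its Frobenioid-theoretic manifestations* [EtTh], Publ. RIMS **45**
(2009), §2 Def. 2.1 p. 36 («`Π̄^ell_X ↠ Q` … the restricted map `D_x → Q` is trivial»), Rmk. 2.1.1 p. 36, Prop. 2.2
p. 37, Def. 2.3 p. 38, Def. 2.5 (i)(a) p. 39 («the quotient `Π̄_X ↠ Q` factors through the natural quotient
`Π^tp_X ↠ Z`») (PRIMS text pages) [cite: MochizukiEtTh2009, Def 2.1 p.36] [cite: MochizukiEtTh2009, Def 2.5 p.39].
Cell `abc-iut`, F lane (FACT-LIST rows F-0640 `ThetaOrbitData.Cor28_i` / F-0641 `Cor28_iii`), seat abc-iut-f-128 (gen 14),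
follow-up «CΘ-FAITHFUL TOY» to the toy NEGATIVE of `ThetaRootOrbitsMonodromyToyCor28i.lean` (★ `not_cor28_i`, diagnosis
`not_def25Conditions`); abc-iut-L2-lead custody (R1504/R1515 rails: count-neutral, SHAPES first, lane D).

WHAT CHANGES.  abc-iut-w6-d084's `monodromyModel l hl` (`ThetaCoversMonodromyModel{Defs,Theta,Tempered,Aut}.lean`) realises
Def. 2.1's rank-one quotient `Q` of `Δ̄^ell_X` by the coordinate `b` (`Π_{X̲} = Φ⁻¹{b = 0, rotation}`: «the covering
`X̲ → X` kills the `a`-cycle, NOT the loop»), so the loop `t` lies in `Π^tp_{X̲}` and Def. 2.5 (i)(a) `Π^tp_Y ⊆ Π^tp_{X̲}`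
FAILS there.  Here, over the SAME profinite data `coverDataAx' l hl` (`Π_C = (TG l)^∧`, `Φ : Π_C ↠ (ℤ/l × ℤ/l) ⋊ D_l`,
`G_K = 1`) and the SAME tempered layer (`Π^tp_C = TG l`, `toHat`, `Π^tp_Y`, `Π^tp_Ÿ`, `Π^tp_Ċ` unchanged), `Q` is realised
by the LOOP INDEX mod `l`, as print's Def. 2.5 (i)(a) demands:
* `Π_{C̲} := Φ⁻¹(heisVS)`, `heisVS = (ℤ/l × ℤ/l) ⋊ {1, s}` (`PiCuL`); `Π_{X̲} = Π_{C̲} ∩ Π_X = Φ⁻¹((ℤ/l × ℤ/l) ⋊ 1)` is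
  the kernel of the rotation index `Π_X ↠ ⟨r⟩ ≅ ℤ/l` (`rotChar`) — type `(1, l-tors)±` (`isTypeLTorsPm_PiCuL`);
* `ι := η(s)` (abc-iut-w6-d084's `iotaM`), `E := Φ⁻¹(b-axis)` (`EL`; the `(−1)`-eigenspace of `ι` on
  `Δ̄_{X̲} = (ℤ/l)²`: `ι·(b, c) = (−b, c)`), `S := Ker Φ`; `Π_{C̲̲} := (S ⊔ E) ⊔ ⟨ι⟩ = Φ⁻¹(b-axis ⋊ {1, s})` is of type
  `(1, l-torsΘ)±` (`isTypeLTorsThetaPm_PiCuuL`, `PiCuuL_eq`);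
* **`monodromyModelLoop l hl : TemperedCoverData l`** `:= { monodromyModel l hl with PiCuu := PiCuuL l, … }`;
* the tower in coordinates `g = (((b, c), d), e)`: `Π^tp_{C̲̲} = {c = 0, d̄ ∈ {1, s}}`, `Π^tp_{X̲̲} = {c = 0, d̄ = 1}`,
  `Π^tp_{X̲} = {d̄ = 1}`, `Π^tp_{C̲} = {d̄ ∈ {1, s}}` (`d̄` = `d` mod `l`), and **Def. 2.5 (i)(a) HOLDS**:
  `Π^tp_Y = {d = 1} ⊆ Π^tp_{X̲}` (`def25Conditions_monodromyModelLoop`); `Π^tp_{Ÿ̲̲} = Π^tp_Ÿ ∩ Π^tp_{X̲̲}` = the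
  `b`-axis `≅ ℤ/l` (non-trivial).
Sequel (PROOF-ONLY): at the print-recipe orbit datum over THIS carrier the typed Cor. 2.8 (i) and (iii) HOLD for every
`Γ` — the loop is no longer inside `Π^tp_{C̲}`, and any `Γ` stabilising `Π^tp_{C̲}` sends `ι` to a reflection `s r^j`,
`l ∣ j`, which forces the shear of `Γ` on `Π^tp_Ÿ` to vanish.

HONEST LABEL (abc-iut-L2-lead R1352, verbatim, inherited from the carrier): «a DESIGNED tempered toy with print's monodromy
combinatorics — loop ↦ `Δ̄^ell` (`b`-cycle), the inversion INVERTS it, unipotent monodromy `x ↦ x·z` on the `a`-cycle,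
`z` = cusp inertia = `Δ̄_Θ` central; `G_K := 1`; NOT a Tate curve, NOT the tempered fundamental group of a curve;
consistency ≠ faithfulness; nothing here takes a side on anything printed.»  «Def-2.5-faithful» refers to clause (i)(a)
ONLY.  DEF-BEARING (class (b) MODEL/CONSTRUCTION: new subgroups and one new `TemperedCoverData` over an existing carrier;
the interfaces of abc-iut-L2-t2 and the files of abc-iut-w6-d084 are INSTANTIATED, never edited; 0 `instance`, 0
notation).  No bearing on [IUTchIII] Cor. 3.12; no side taken; typed ≠ proved.
-/

noncomputable section

namespace Literature.AnabelianGeometry.EtaleTheta.ThetaCovers.MonodromyModel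

open Multiplicative HeisenbergWitness TemperedModel DihedralGroup

variable (l : ℕ)

/-! ## 2. The Def. 2.1 / 2.3 data over `Π_C`: `Π_{C̲}`, `E`, `Π_{C̲̲}` cut by the loop -/

section Profinite

variable [NeZero l]

/-- **`Π_{C̲} := Φ⁻¹((ℤ/l × ℤ/l) ⋊ {1, s})`** — `X̲ → X` kills the LOOP index mod `l`. (toy bookkeeping for the typed
interface of [EtTh] Def. 2.1; no claim about print) [cite: MochizukiEtTh2009, Def 2.1 p.36] -/
def PiCuL : Subgroup (PiC l) := (heisVS l).comap (Phi l)

/-- **`E := Φ⁻¹(b-axis)`**, the `(−1)`-eigenspace datum of Prop. 2.2 (i). (toy bookkeeping; no claim about print)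
[cite: MochizukiEtTh2009, Prop 2.2 p.37] -/
def EL : Subgroup (PiC l) := (heisBax l).comap (Phi l)

/-- **`Π_{C̲̲} := (Ker Φ ⊔ E) ⊔ ⟨ι⟩`** (Def. 2.3 with `S := Ker Φ`, `ι := η(s)`). (toy bookkeeping for the typed interface
of [EtTh] Def. 2.3; no claim about print) [cite: MochizukiEtTh2009, Def 2.3 p.38] -/
def PiCuuL : Subgroup (PiC l) := ((⊥ : Subgroup (heisPiC l)).comap (Phi l) ⊔ EL l) ⊔ Subgroup.zpowers (iotaM l)

/-- The rotation-index character `heisPiX → ℤ/l`, `((b, c), r^i) ↦ i` — Def. 2.1's quotient `Q` REALISED BY THE LOOP.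
(toy bookkeeping for [EtTh] Def. 2.1 «`Π̄^ell_X ↠ Q`»; no claim about print) [cite: MochizukiEtTh2009, Def 2.1 p.36] -/
def rotChar : ↥(heisPiX l) →* Multiplicative (ZMod l) where
  toFun x := ofAdd (rotIdx l (x : heisPiC l).right)
  map_one' := by simp
  map_mul' x y := by
    obtain ⟨i, hi⟩ := (mem_heisPiX l).mp x.2
    obtain ⟨j, hj⟩ := (mem_heisPiX l).mp y.2
    apply toAdd.injective
    rw [toAdd_ofAdd, toAdd_mul, toAdd_ofAdd, toAdd_ofAdd, Subgroup.coe_mul, SemidirectProduct.mul_right, hi, hj,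
      r_mul_r, rotIdx_r, rotIdx_r, rotIdx_r]

omit [NeZero l] in
/-- `rotChar` is surjective (`r^i ↦ i`). (toy bookkeeping) [cite: MochizukiEtTh2009, Def 2.1 p.36] -/
theorem rotChar_surjective : Function.Surjective (rotChar l) := fun i =>
  ⟨⟨SemidirectProduct.inr (r (toAdd i)), (mem_heisPiX l).mpr ⟨toAdd i, rfl⟩⟩, by
    apply toAdd.injective
    show rotIdx l (r (toAdd i)) = toAdd i
    rw [rotIdx_r]⟩

omit [NeZero l] in
/-- `Ker(rotChar) = heisV`. (toy bookkeeping) [cite: MochizukiEtTh2009, Def 2.1 p.36] -/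
theorem rotChar_eq_one_iff (x : ↥(heisPiX l)) : rotChar l x = 1 ↔ (x : heisPiC l) ∈ heisV l := by
  obtain ⟨i, hi⟩ := (mem_heisPiX l).mp x.2
  rw [mem_heisV, hi, one_def]
  show ofAdd (rotIdx l (x : heisPiC l).right) = 1 ↔ _
  rw [hi, rotIdx_r, ← ofAdd_zero, ofAdd.apply_eq_iff_eq]
  exact ⟨fun h => by rw [h], fun h => by injection h⟩

variable (hl : Odd l)

/-- `Π_{X̲} := Π_{C̲} ∩ Π_X = Φ⁻¹(heisV)` is of type `(1, l-tors)` — the quotient is the LOOP index. (toy bookkeeping for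
the typed interface of [EtTh] Def. 2.1; no claim about print) [cite: MochizukiEtTh2009, Def 2.1 p.36] -/
theorem isTypeLTors_inf_L : (coverDataAx' l hl).toCoverData.IsTypeLTors (PiCuL l ⊓ (coverDataAx' l hl).PiX) where
  le := inf_le_right
  quot := by
    refine ⟨(rotChar l).comp ((Phi l).subgroupComap (heisPiX l)),
      (rotChar_surjective l).comp ((Phi l).subgroupComap_surjective_of_surjective _ (Phi_surjective l)), fun g => ?_⟩
    change rotChar l ((Phi l).subgroupComap (heisPiX l) g) = 1 ↔ (g : PiC l) ∈ PiCuL l ⊓ (heisPiX l).comap (Phi l)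
    rw [rotChar_eq_one_iff, PiCuL, ← Subgroup.comap_inf, heisVS_inf_heisPiX]
    rfl
  barTheta_le := by
    change (heisTheta l).comap (Phi l) ≤ PiCuL l ⊓ (heisPiX l).comap (Phi l)
    rw [PiCuL, ← Subgroup.comap_inf, heisVS_inf_heisPiX]
    exact Subgroup.comap_mono (heis_le l).1
  delta_sup := by
    change (PiCuL l ⊓ (coverDataAx' l hl).PiX) ⊔ ((coverDataAx' l hl).PiX ⊓ (coverDataAx' l hl).aug.ker) = _
    rw [aug_ker_eq_top, inf_top_eq]
    exact sup_eq_right.mpr inf_le_right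
  Dx_le := by
    change (heisTheta l).comap (Phi l) ≤ PiCuL l ⊓ (heisPiX l).comap (Phi l)
    rw [PiCuL, ← Subgroup.comap_inf, heisVS_inf_heisPiX]
    exact Subgroup.comap_mono (heis_le l).1

/-- `Π_{C̲} = Φ⁻¹(heisVS)` is of type `(1, l-tors)±`. (toy bookkeeping) [cite: MochizukiEtTh2009, Def 2.1 p.36] -/
theorem isTypeLTorsPm_PiCuL : (coverDataAx' l hl).toCoverData.IsTypeLTorsPm (PiCuL l) where
  inf_isTypeLTors := isTypeLTors_inf_L l hl
  relIndex_two := by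
    change ((heisVS l).comap (Phi l) ⊓ (heisPiX l).comap (Phi l)).relIndex ((heisVS l).comap (Phi l)) = 2
    rw [← Subgroup.comap_inf, Subgroup.relIndex_comap, Subgroup.map_comap_eq_self_of_surjective (Phi_surjective l),
      relIndex_heisVS_inf]

/-- `ι = η(s)` is an inversion for `Π_{C̲} = Φ⁻¹(heisVS)`. (toy bookkeeping) [cite: MochizukiEtTh2009, Prop 2.2 p.37] -/
theorem isInversion_iotaM_L : (coverDataAx' l hl).toCoverData.IsInversion (PiCuL l) (iotaM l) where
  mem := by
    change iotaM l ∈ (heisVS l).comap (Phi l)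
    rw [Subgroup.mem_comap, Phi_iotaM]
    exact (mem_heisVS l).mpr (Or.inr rfl)
  mem_delta := by
    change iotaM l ∈ (coverDataAx' l hl).aug.ker
    rw [aug_ker_eq_top]; trivial
  not_mem := by
    change iotaM l ∉ (heisPiX l).comap (Phi l)
    rw [Subgroup.mem_comap, Phi_iotaM]
    exact inr_sr_not_mem_heisPiX l 0

/-- `E = Φ⁻¹(b-axis)` is the `(−1)`-eigenspace datum of Prop. 2.2 (i) for `(Π_{X̲}, Π_{C̲}, ι)` cut by the loop.
(toy bookkeeping for the typed interface of [EtTh] Prop. 2.2 (i); no claim about print) [cite: MochizukiEtTh2009, Prop 2.2 p.37] -/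
theorem isMinusEigen_EL :
    (coverDataAx' l hl).toCoverData.IsMinusEigen (PiCuL l ⊓ (coverDataAx' l hl).PiX) (PiCuL l) (iotaM l) (EL l) where
  barKer_le := Subgroup.comap_mono bot_le
  le := by
    change EL l ≤ (PiCuL l ⊓ (heisPiX l).comap (Phi l)) ⊓ (coverDataAx' l hl).aug.ker
    rw [aug_ker_eq_top, inf_top_eq, PiCuL, ← Subgroup.comap_inf, heisVS_inf_heisPiX]
    exact Subgroup.comap_mono (heis_le l).2.1
  conj_mem := by
    intro g hg e he
    change g ∈ (heisVS l).comap (Phi l) ⊓ (heisPiX l).comap (Phi l) at hg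
    rw [← Subgroup.comap_inf, heisVS_inf_heisPiX] at hg
    change Phi l (g * e * g⁻¹) ∈ heisBax l
    rw [map_mul, map_mul, map_inv]
    exact conj_mem_heisBax l hg he
  inf_eq := by
    change EL l ⊓ (heisTheta l).comap (Phi l) = (⊥ : Subgroup (heisPiC l)).comap (Phi l)
    rw [EL, ← Subgroup.comap_inf, heisBax_inf_heisTheta]
  sup_eq := by
    change EL l ⊔ (heisTheta l).comap (Phi l) = (PiCuL l ⊓ (heisPiX l).comap (Phi l)) ⊓ (coverDataAx' l hl).aug.ker
    rw [aug_ker_eq_top, inf_top_eq, EL, PiCuL, Subgroup.comap_sup_eq (Phi l) _ _ (Phi_surjective l),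
      heisBax_sup_heisTheta, ← Subgroup.comap_inf, heisVS_inf_heisPiX]
  minus := by
    intro e he
    change Phi l (iotaM l * e * (iotaM l)⁻¹ * e) ∈ (⊥ : Subgroup (heisPiC l))
    rw [map_mul, map_mul, map_mul, map_inv, Phi_iotaM, Subgroup.mem_bot]
    exact sr_conj_mul_self_heisBax l he
  plus := by
    intro t ht
    change Phi l (iotaM l * t * (iotaM l)⁻¹ * t⁻¹) ∈ (⊥ : Subgroup (heisPiC l))
    rw [map_mul, map_mul, map_mul, map_inv, map_inv, Phi_iotaM, Subgroup.mem_bot]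
    exact sr_conj_theta_eq l ht
  iota_conj := by
    intro e he
    change Phi l (iotaM l * e * (iotaM l)⁻¹) ∈ heisBax l
    rw [map_mul, map_mul, map_inv, Phi_iotaM]
    exact sr_conj_mem_heisBax l he

/-- **`Π_{C̲̲} := (Ker Φ ⊔ E) ⊔ ⟨ι⟩` cut by the loop is of type `(1, l-torsΘ)±`** (Def. 2.3). (toy bookkeeping for the typed
interface of [EtTh] Def. 2.3; no claim about print) [cite: MochizukiEtTh2009, Def 2.3 p.38] -/
theorem isTypeLTorsThetaPm_PiCuuL : (coverDataAx' l hl).toCoverData.IsTypeLTorsThetaPm (PiCuuL l) :=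
  ⟨⟨PiCuL l, EL l, (coverDataAx' l hl).barKer, iotaM l, isTypeLTorsPm_PiCuL l hl, isInversion_iotaM_L l hl,
    by rw [iotaM_mul_self]; exact Subgroup.one_mem _, isMinusEigen_EL l hl, isSplitting_barKer l hl, rfl⟩⟩

omit [NeZero l] in
/-- `Π_{C̲̲} = Φ⁻¹(b-axis ⋊ {1, s})`: the three-piece definition is a single preimage. (toy bookkeeping)
[cite: MochizukiEtTh2009, Def 2.3 p.38] -/
theorem PiCuuL_eq [NeZero l] : PiCuuL l = (heisBS l).comap (Phi l) := by
  refine le_antisymm (sup_le (sup_le (Subgroup.comap_mono bot_le) (Subgroup.comap_mono (heis_le l).2.2.2.1)) ?_) ?_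
  · rw [Subgroup.zpowers_le, Subgroup.mem_comap, Phi_iotaM]
    exact ⟨Or.inr rfl, γ_inr l _⟩
  · intro x hx
    rw [Subgroup.mem_comap, mem_heisBS] at hx
    rcases hx.1 with hd | hd
    · exact Subgroup.mem_sup_left (Subgroup.mem_sup_right ((mem_heisBax l).mpr ⟨hd, hx.2⟩))
    · have hy : x * (iotaM l)⁻¹ ∈ EL l := by
        refine (mem_heisBax l).mpr ⟨?_, ?_⟩
        · rw [map_mul, map_inv, Phi_iotaM, SemidirectProduct.mul_right, SemidirectProduct.inv_right,
            SemidirectProduct.right_inr, hd, inv_sr, sr_mul_sr, sub_self, one_def]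
        · rw [map_mul, map_inv, Phi_iotaM, γ_mul, γ_inv, hd, hx.2]
          simp
      rw [← inv_mul_cancel_right x (iotaM l)]
      exact Subgroup.mul_mem _ (Subgroup.mem_sup_left (Subgroup.mem_sup_right hy))
        (Subgroup.mem_sup_right (Subgroup.mem_zpowers _))

/-- `Π_{C̲̲}` cut by the loop is open in `Π_C` (it contains the open `Ker Φ`). (toy bookkeeping) [cite: MochizukiEtTh2009, Def 2.3 p.38] -/
theorem isOpen_PiCuuL : IsOpen (PiCuuL l : Set (PiC l)) := by
  have hle : (Phi l).ker ≤ PiCuuL l := by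
    rw [← MonoidHom.comap_bot]
    exact le_sup_left.trans le_sup_left
  refine Subgroup.isOpen_mono hle ?_
  have h : ((Phi l).ker : Set (PiC l)) = Phi l ⁻¹' {1} := by
    ext x; simp [MonoidHom.mem_ker]
  rw [h]
  letI : TopologicalSpace (heisPiC l) := ⊥
  haveI : DiscreteTopology (heisPiC l) := ⟨rfl⟩
  exact (continuous_Phi l ⊥).isOpen_preimage _ (isOpen_discrete _)

/-! ## 3. The inhabitant `monodromyModelLoop l hl : TemperedCoverData l` and its tower in coordinates -/

/-- **THE MONODROMY TOY WITH THE LOOP-CUT `(1, l-tors)` COVERING**: abc-iut-w6-d084's `monodromyModel l hl` with the single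
field `PiCuu` (and its two proofs) replaced — `Π_{C̲̲} := Φ⁻¹(b-axis ⋊ {1, s})`, so that `Π_{X̲} = Φ⁻¹((ℤ/l × ℤ/l) ⋊ 1)` is
cut out by the LOOP INDEX mod `l` and Def. 2.5 (i)(a) holds.  Same `Π^tp_C = TG l`, `Π^tp_Y`, `Π^tp_Ÿ`, `Π^tp_Ċ`, `Δ̄_Θ`,
`G_K = 1`.  CONSISTENCY WITNESS ONLY (R1352 label in the header). [cite: MochizukiEtTh2009, Def 2.5 p.39] -/
@[reducible] def monodromyModelLoop : TemperedCoverData.{0} l :=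
  { monodromyModel l hl with
    PiCuu := PiCuuL l
    isTypeLTorsThetaPm := isTypeLTorsThetaPm_PiCuuL l hl
    isOpen_PiCuu' := isOpen_PiCuuL l }

/-- `Π^tp_{C̲̲} = PhiT⁻¹(heisBS) = {c = 0, d̄ ∈ {1, s}}`. (toy bookkeeping for [EtTh] Def. 2.5; no claim about print)
[cite: MochizukiEtTh2009, Def 2.5 p.39] -/
theorem tp_PiCuu_loop : (monodromyModelLoop l hl).tp (monodromyModelLoop l hl).PiCuu = (heisBS l).comap (PhiT l) := by
  change (PiCuuL l).comap (toHat l).toMonoidHom = _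
  rw [PiCuuL_eq, comap_toHat_comap_Phi]

/-- `Π^tp_X = PhiT⁻¹(heisPiX)` (unchanged). (toy bookkeeping) [cite: MochizukiEtTh2009, Def 2.5 p.39] -/
theorem tp_PiX_loop : (monodromyModelLoop l hl).tp (monodromyModelLoop l hl).PiX = (heisPiX l).comap (PhiT l) :=
  comap_toHat_comap_Phi l _

/-- `Π^tp_{X̲̲} = PhiT⁻¹(b-axis) = {c = 0, d̄ = 1}`. (toy bookkeeping) [cite: MochizukiEtTh2009, Def 2.5 p.39] -/
theorem tp_PiXuu_loop : (monodromyModelLoop l hl).tp (monodromyModelLoop l hl).PiXuu = (heisBax l).comap (PhiT l) := by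
  change (PiCuuL l ⊓ (heisPiX l).comap (Phi l)).comap (toHat l).toMonoidHom = _
  rw [PiCuuL_eq, ← Subgroup.comap_inf, heisBS_inf_heisPiX, comap_toHat_comap_Phi]

/-- `Π^tp_{X̲} = PhiT⁻¹(heisV) = {d̄ = 1}`. (toy bookkeeping) [cite: MochizukiEtTh2009, Def 2.5 p.39] -/
theorem tp_PiXu_loop : (monodromyModelLoop l hl).tp (monodromyModelLoop l hl).PiXu = (heisV l).comap (PhiT l) := by
  change ((PiCuuL l ⊓ (heisPiX l).comap (Phi l)) ⊔ (heisTheta l).comap (Phi l)).comap (toHat l).toMonoidHom = _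
  rw [PiCuuL_eq, ← Subgroup.comap_inf, Subgroup.comap_sup_eq (Phi l) _ _ (Phi_surjective l), heisBS_inf_heisPiX,
    heisBax_sup_heisTheta, comap_toHat_comap_Phi]

/-- `Π^tp_{C̲} = PhiT⁻¹(heisVS) = {d̄ ∈ {1, s}}`. (toy bookkeeping) [cite: MochizukiEtTh2009, Def 2.5 p.39] -/
theorem tp_PiCu_loop : (monodromyModelLoop l hl).tp (monodromyModelLoop l hl).PiCu = (heisVS l).comap (PhiT l) := by
  change (PiCuuL l ⊔ (heisTheta l).comap (Phi l)).comap (toHat l).toMonoidHom = _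
  rw [PiCuuL_eq, Subgroup.comap_sup_eq (Phi l) _ _ (Phi_surjective l), heisBS_sup_heisTheta, comap_toHat_comap_Phi]

omit [NeZero l] in
/-- Membership in the loop-cut members, in coordinates (`d̄ := dihedralRed l d`). (toy bookkeeping)
[cite: MochizukiEtTh2009, Def 2.5 p.39] -/
theorem mem_loop_members_iff (g : TG l) :
    (g ∈ (heisV l).comap (PhiT l) ↔ dihedralRed l g.1.right = 1) ∧
    (g ∈ (heisVS l).comap (PhiT l) ↔ dihedralRed l g.1.right = 1 ∨ dihedralRed l g.1.right = sr 0) ∧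
    (g ∈ (heisBax l).comap (PhiT l) ↔ dihedralRed l g.1.right = 1 ∧ cC l g = 0) ∧
    (g ∈ (heisBS l).comap (PhiT l) ↔ (dihedralRed l g.1.right = 1 ∨ dihedralRed l g.1.right = sr 0) ∧ cC l g = 0) :=
  ⟨Iff.rfl, Iff.rfl, Iff.rfl, Iff.rfl⟩

/-- **Def. 2.5 (i)(a) HOLDS at the loop-cut toy**: `Π^tp_Y = {d = 1} ⊆ Π^tp_{X̲} = {d̄ = 1}` — the quotient `Q` factors
through the loop index `Π^tp_X ↠ Z` (for any parameter `IsPmCompatible` that holds at `Π_{X̲̲}`; here the trivially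
true one — the `{±1}`-structure notion is abc-iut-L2-t1's and not modelled). Contrast `not_def25Conditions` at
`monodromyModel`. (toy bookkeeping for [EtTh] Def. 2.5 (i); no claim about print) [cite: MochizukiEtTh2009, Def 2.5 p.39] -/
theorem def25Conditions_monodromyModelLoop : (monodromyModelLoop l hl).Def25Conditions fun _ => True := by
  refine ⟨fun g hg => ?_, trivial⟩
  rw [tp_PiXu_loop, (mem_loop_members_iff l g).1, (mem_PiYT l).mp hg, map_one]

/-- `Π^tp_{Ÿ̲̲} = Π^tp_Ÿ ∩ Π^tp_{X̲̲}` of the loop-cut toy is the `b`-axis `{c = 0, d = 1, e = 1} ≅ ℤ/l` — NON-trivial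
(contrast `Π^tp_{Ÿ̲̲} = 1` at `monodromyModel`). (toy bookkeeping for [EtTh] Def. 2.7 «`Π^tp_{Ÿ̲̲}`»; no claim about print)
[cite: MochizukiEtTh2009, Def 2.7 p.41] -/
theorem mem_PiYddT_inf_tp_PiXuu_loop (g : TG l) :
    g ∈ PiYddT l ⊓ (monodromyModelLoop l hl).tp (monodromyModelLoop l hl).PiXuu ↔
      g.1.right = 1 ∧ g.2 = 1 ∧ cC l g = 0 := by
  rw [tp_PiXuu_loop, Subgroup.mem_inf, mem_PiYddT_iff, (mem_loop_members_iff l g).2.2.1]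
  constructor
  · rintro ⟨⟨hd, he⟩, -, hc⟩
    exact ⟨hd, he, hc⟩
  · rintro ⟨hd, he, hc⟩
    exact ⟨⟨hd, he⟩, by rw [hd, map_one], hc⟩

end Profinite

end Literature.AnabelianGeometry.EtaleTheta.ThetaCovers.MonodromyModel

end
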